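import Literature.Algebra.Polynomial.CasasAlvero.DigitCriterion
import Mathlib.Tactic.LinearCombination
import HarnessLib

/-!
# Trinomial Casas-Alvero polynomials: a two-witness criterion for bad degrees in characteristic `p`

The binomial criterion (`DigitCriterion.lean`: `X^d - X^m` is Casas-Alvero iff `binom(d,m) = 1` in `K`) decides many base-`p`
digits but not all.  The next sparsest family is the centred trinomial `f = X^d + s X^m + t X^n` with `0 < n < m < d`: since
`f(0) = 0` and every coefficient outside `{n, m, d}` vanishes, VACUITY (`sharesRoot_of_coeff_eq_zero`) discharges every Hasse
index `i ∉ {n, m}` with the root `0`, so `f` is Casas-Alvero as soon as TWO witnesses exist: a root `ρ` of `f` with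
`(H_m f)(ρ) = binom(d,m) ρ^(d-m) + s = 0` and a root `σ` of `f` with `(H_n f)(σ) = binom(d,n) σ^(d-n) + binom(m,n) s σ^(m-n) + t = 0`;
and `f` is not a pure `d`-th power when `t ≠ 0`.  Hence (`not_holdsInDegree_of_trinomial`) four polynomial identities in `K`
refute `CA_d(K)`; over a prime field they are integer congruences, so each instance is a one-line kernel computation, and it
refutes `CA_d` over EVERY field of that characteristic (prime-field coefficients and witnesses).

Instances (exhaustive search over centred trinomials with `𝔽_p`-rational witnesses, `cls/sparse_search.py` of the seat-2 g5
packet, double-checked by the independent `cls/check2.py`): in characteristic `19`, `X^11 + X^3 + 7X^2` (`ρ = 13`, `σ = 11`),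
`X^16 - 4X^10 + 3X^2` (`ρ = 4`, `σ = 1`), `X^17 + 4X^4 + X` (`ρ = 2`, `σ = 6`) — the three base-`19` digits `11, 16, 17` that
neither the binomial criterion nor the earlier files decide; with them the classification of Casas-Alvero degrees in
characteristic `19` closes (`CharNineteenComplete.lean`).  [folklore]
-/

noncomputable section

open Polynomial

namespace Literature.Algebra.Polynomial.CasasAlvero

section Trinomial

variable {K : Type*} [Field K]

variable {d m n : ℕ}

/-- the tail has degree `< d`. [folklore] -/
theorem natDegree_trinom_tail_lt (hnm : n < m) (hmd : m < d) (s t : K) :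
    (s • (X : K[X]) ^ m + t • X ^ n).natDegree < d := by
  refine lt_of_le_of_lt (natDegree_add_le _ _) (max_lt ?_ ?_)
  · exact lt_of_le_of_lt (le_trans (natDegree_smul_le _ _) (natDegree_X_pow_le m)) hmd
  · exact lt_of_le_of_lt (le_trans (natDegree_smul_le _ _) (natDegree_X_pow_le n)) (lt_trans hnm hmd)

/-- its degree is `d`. [folklore] -/
theorem natDegree_trinom (hnm : n < m) (hmd : m < d) (s t : K) : (X ^ d + s • X ^ m + t • X ^ n : K[X]).natDegree = d := by
  rw [add_assoc, natDegree_add_eq_left_of_natDegree_lt]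
  · exact natDegree_X_pow d
  · rw [natDegree_X_pow]; exact natDegree_trinom_tail_lt hnm hmd s t

/-- it is monic. [folklore] -/
theorem monic_trinom (hnm : n < m) (hmd : m < d) (s t : K) : (X ^ d + s • X ^ m + t • X ^ n : K[X]).Monic := by
  have h := natDegree_trinom_tail_lt hnm hmd s t
  rw [add_assoc]
  exact (monic_X_pow d).add_of_left
    (lt_of_le_of_lt degree_le_natDegree (by rw [degree_X_pow]; exact_mod_cast h))

/-- coefficients of the trinomial. [folklore] -/
theorem coeff_trinom (s t : K) (i : ℕ) :
    (X ^ d + s • X ^ m + t • X ^ n : K[X]).coeff i = (if i = d then 1 else 0) + (if i = m then s else 0) + (if i = n then t else 0) := by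
  simp only [coeff_add, coeff_smul, coeff_X_pow, smul_eq_mul, mul_ite, mul_one, mul_zero]

/-- evaluation of the trinomial. [folklore] -/
theorem eval_trinom (s t x : K) : (X ^ d + s • X ^ m + t • X ^ n : K[X]).eval x = x ^ d + s * x ^ m + t * x ^ n := by
  simp only [eval_add, eval_smul, eval_pow, eval_X, smul_eq_mul]

/-- evaluation of its `m`-th Hasse derivative (`binom(n,m) = 0` as `n < m`). [folklore] -/
theorem eval_hasseDeriv_trinom_m (hnm : n < m) (s t x : K) :
    (hasseDeriv m (X ^ d + s • X ^ m + t • X ^ n : K[X])).eval x = (d.choose m : K) * x ^ (d - m) + s := by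
  simp only [map_add, map_smul, hasseDeriv_X_pow, eval_add, eval_smul, eval_mul, eval_C, eval_pow, eval_X, smul_eq_mul,
    Nat.choose_self, Nat.sub_self, pow_zero, mul_one, Nat.cast_one, Nat.choose_eq_zero_of_lt hnm, Nat.cast_zero,
    zero_mul, mul_zero, add_zero]

/-- evaluation of its `n`-th Hasse derivative. [folklore] -/
theorem eval_hasseDeriv_trinom_n (s t x : K) :
    (hasseDeriv n (X ^ d + s • X ^ m + t • X ^ n : K[X])).eval x =
      (d.choose n : K) * x ^ (d - n) + (m.choose n : K) * s * x ^ (m - n) + t := by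
  simp only [map_add, map_smul, hasseDeriv_X_pow, eval_add, eval_smul, eval_mul, eval_C, eval_pow, eval_X, smul_eq_mul,
    Nat.choose_self, Nat.sub_self, pow_zero, mul_one, Nat.cast_one]
  ring

/-- **two-witness criterion**: a centred trinomial with a root killing `H_m` and a root killing `H_n` is Casas-Alvero
(all other Hasse indices are vacuous at the root `0`). [folklore] -/
theorem isCasasAlvero_trinom (hn0 : 0 < n) (hnm : n < m) (hmd : m < d) {s t ρ σ : K}
    (hρf : (X ^ d + s • X ^ m + t • X ^ n : K[X]).eval ρ = 0) (hρH : (hasseDeriv m (X ^ d + s • X ^ m + t • X ^ n : K[X])).eval ρ = 0)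
    (hσf : (X ^ d + s • X ^ m + t • X ^ n : K[X]).eval σ = 0) (hσH : (hasseDeriv n (X ^ d + s • X ^ m + t • X ^ n : K[X])).eval σ = 0) :
    IsCasasAlvero (X ^ d + s • X ^ m + t • X ^ n : K[X]) := by
  intro i hi0 hi
  rw [natDegree_trinom hnm hmd] at hi
  by_cases him : i = m
  · subst him; exact ⟨ρ, hρf, hρH⟩
  by_cases hin : i = n
  · subst hin; exact ⟨σ, hσf, hσH⟩
  apply sharesRoot_of_coeff_eq_zero
  · rw [eval_trinom, zero_pow (by omega), zero_pow (by omega), zero_pow (by omega)]; ring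
  · rw [coeff_trinom, if_neg (by omega), if_neg him, if_neg hin]; ring

/-- a centred trinomial with `t ≠ 0` is not a pure `d`-th power. [folklore] -/
theorem trinom_ne_pow (hn0 : 0 < n) (hnm : n < m) (hmd : m < d) {s t : K} (ht : t ≠ 0) (a : K) :
    (X ^ d + s • X ^ m + t • X ^ n : K[X]) ≠ (X - C a) ^ d := by
  intro h
  have h0 := congrArg (eval 0) h
  rw [eval_trinom, zero_pow (by omega), zero_pow (by omega), zero_pow (by omega)] at h0
  simp only [mul_zero, add_zero, eval_pow, eval_sub, eval_X, eval_C, zero_sub] at h0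
  have ha : a = 0 := neg_eq_zero.mp ((pow_eq_zero_iff (by omega : d ≠ 0)).mp h0.symm)
  subst ha
  have hc := congrArg (fun q : K[X] => q.coeff n) h
  simp only [coeff_trinom, map_zero, sub_zero, coeff_X_pow, if_neg (by omega : ¬ n = d), if_neg (ne_of_lt hnm), zero_add] at hc
  exact ht hc

/-- **trinomial refutation of `CA_d`**: four identities in `K` (two roots of `X^d + sX^m + tX^n`, one killing `H_m`, one killing
`H_n`) and `t ≠ 0` give a Casas-Alvero polynomial of degree `d` over `K` that is not a `d`-th power. [folklore] -/
theorem not_holdsInDegree_of_trinomial (hn0 : 0 < n) (hnm : n < m) (hmd : m < d) {s t : K} (ht : t ≠ 0) (ρ σ : K)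
    (h1 : ρ ^ d + s * ρ ^ m + t * ρ ^ n = 0) (h2 : (d.choose m : K) * ρ ^ (d - m) + s = 0)
    (h3 : σ ^ d + s * σ ^ m + t * σ ^ n = 0)
    (h4 : (d.choose n : K) * σ ^ (d - n) + (m.choose n : K) * s * σ ^ (m - n) + t = 0) :
    ¬ HoldsInDegree K d := by
  intro h
  have hCA : IsCasasAlvero (X ^ d + s • X ^ m + t • X ^ n : K[X]) :=
    isCasasAlvero_trinom hn0 hnm hmd (by rw [eval_trinom]; exact h1) (by rw [eval_hasseDeriv_trinom_m hnm]; exact h2)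
      (by rw [eval_trinom]; exact h3) (by rw [eval_hasseDeriv_trinom_n]; exact h4)
  obtain ⟨a, ha⟩ := h _ (monic_trinom hnm hmd s t) (natDegree_trinom hnm hmd s t) hCA
  exact trinom_ne_pow hn0 hnm hmd ht a ha

end Trinomial

/-! ### Instances in characteristic 19 -/

section Char19

variable (K : Type*) [Field K]

/-- `X^11 + X^3 + 7X^2` refutes `CA_11` in characteristic `19` (`H_3`-witness `13`, `H_2`-witness `11`). [folklore] -/
theorem not_holdsInDegree_eleven_of_char_19 [CharP K 19] : ¬ HoldsInDegree K 11 := by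
  have hp : (19 : K) = 0 := by simpa using CharP.cast_eq_zero K 19
  refine not_holdsInDegree_of_trinomial (d := 11) (m := 3) (n := 2) (by norm_num) (by norm_num) (by norm_num)
    (s := 1) (t := 7) ?_ 13 11 ?_ ?_ ?_ ?_
  · intro h
    have h' : ((7 : ℕ) : K) = 0 := by exact_mod_cast h
    rw [CharP.cast_eq_zero_iff K 19] at h'
    norm_num at h'
  · linear_combination (94324231443 : K) * hp
  · simp only [show Nat.choose 11 3 = 165 from rfl]
    push_cast
    linear_combination (7083977314 : K) * hp
  · linear_combination (15016403831 : K) * hp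
  · simp only [show Nat.choose 11 2 = 55 from rfl, show Nat.choose 3 2 = 3 from rfl]
    push_cast
    linear_combination (6825638055 : K) * hp

/-- `X^16 - 4X^10 + 3X^2` refutes `CA_16` in characteristic `19` (`H_10`-witness `4`, `H_2`-witness `1`). [folklore] -/
theorem not_holdsInDegree_sixteen_of_char_19 [CharP K 19] : ¬ HoldsInDegree K 16 := by
  have hp : (19 : K) = 0 := by simpa using CharP.cast_eq_zero K 19
  refine not_holdsInDegree_of_trinomial (d := 16) (m := 10) (n := 2) (by norm_num) (by norm_num) (by norm_num)
    (s := -4) (t := 3) ?_ 4 1 ?_ ?_ ?_ ?_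
  · intro h
    have h' : ((3 : ℕ) : K) = 0 := by exact_mod_cast h
    rw [CharP.cast_eq_zero_iff K 19] at h'
    norm_num at h'
  · linear_combination (225830160 : K) * hp
  · simp only [show Nat.choose 16 10 = 8008 from rfl]
    push_cast
    linear_combination (1726356 : K) * hp
  · linear_combination (0 : K) * hp
  · simp only [show Nat.choose 16 2 = 120 from rfl, show Nat.choose 10 2 = 45 from rfl]
    push_cast
    linear_combination (-3 : K) * hp

/-- `X^17 + 4X^4 + X` refutes `CA_17` in characteristic `19` (`H_4`-witness `2`, `H_1`-witness `6`). [folklore] -/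
theorem not_holdsInDegree_seventeen_of_char_19 [CharP K 19] : ¬ HoldsInDegree K 17 := by
  have hp : (19 : K) = 0 := by simpa using CharP.cast_eq_zero K 19
  refine not_holdsInDegree_of_trinomial (d := 17) (m := 4) (n := 1) (by norm_num) (by norm_num) (by norm_num)
    (s := 4) (t := 1) ?_ 2 6 ?_ ?_ ?_ ?_
  · intro h
    have h' : ((1 : ℕ) : K) = 0 := by exact_mod_cast h
    rw [CharP.cast_eq_zero_iff K 19] at h'
    norm_num at h'
  · linear_combination (6902 : K) * hp
  · simp only [show Nat.choose 17 4 = 2380 from rfl]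
    push_cast
    linear_combination (1026156 : K) * hp
  · linear_combination (890876813154 : K) * hp
  · simp only [show Nat.choose 17 1 = 17 from rfl, show Nat.choose 4 1 = 4 from rfl]
    push_cast
    linear_combination (2524150970011 : K) * hp

end Char19

end Literature.Algebra.Polynomial.CasasAlvero
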